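import Mathlib.Tactic.Linarith
import Mathlib.Tactic.NormNum
import Mathlib.Tactic.Ring
import Mathlib.Tactic.IntervalCases
import HarnessLib

/-!
# The (0,1) cell of the ι-window, XXXVII (companion B): the product ground `B₁ × B₂`, XXIV — THE CORNER IX, ADDENDUM 1
# (report [XXXVII] `H2-ZERO-ONE-37.md` §11): arithmetic shadows of LEMMA P′-LOCAL, LEMMA POWERS, LEMMA SQ and PROPOSITION ISO

Family `hodge`, b2b cell `hweil` (helper of item stmt-HodgeConjecture-2524). Report
`run/shared/lean/b2b/hodge-weil/b2b-hweil-pv1-g49/H2-ZERO-ONE-37.md` ([XXXVII]) §11 (ADDENDUM 1). Context (the report's words, nothing of them formalised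
here): for an isolated connected component `C` of the surface divisor the P′-length it carries is `Y_C·S + Ξ(−S)·D′_C` exactly — `μ·q` on a vertical
S-fibre, `q = a₂ + d₃ − 4` — so that LEMMA FRAME's `|P′| = 2μ′ + 2(a₁ − n′)(a₂ − 2) − 4n′` is `W′·S + p₁h′ + qv′` identically (LEMMA P′-LOCAL); an isolated
vertical S-fibre structure on which `x̃` has a Jordan block of size `b ≥ 3` puts the functions `x̃^{j+2}` (`j + 2 ≤ b − 1`) into the reservoir — `b − 2`
of them on a free orbit, the `⌊(b − 1)/2⌋` even powers on a fixed fibre (LEMMA POWERS); a square-zero structure has `D_C = μ(d₃ − 3)` when isolated and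
`D ≥ 2μ(d₃ − 3) + 1 − τ/2` on an attached free pair (LEMMA SQ); so in the five `h′ = 0` cells at most one vertical S-fibre structure is isolated
(PROPOSITION ISO). The theorems below are the integer identities behind these statements. None of them claims geometry. HONEST FRAMING: census work inside
the ladder's H2 test ((0,1) cell) on the SPECIAL fourfold `X₀`; nothing here is a rung; no case of the Hodge conjecture is proved; no statement of
[Markman 2025] / [Perry 2026] / [EdGFS 2025] is used.
-/

-- mandated namespace `Summit.HodgeConjecture.HodgeConjecture.…` (Problem = Summit) trips `linter.dupNamespace`; the lakefile disables it
-- tree-wide (weak option), restated here so stand-alone elaboration is warning-free too.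
set_option linter.dupNamespace false

namespace Summit.HodgeConjecture.HodgeConjecture.WeilTypeLadder

section ProductGroundTwentyFourB

/-- **[XXXVII] 11.1 (LEMMA P′-LOCAL, the global check).** With `W′·S = 2(μ′ − n₃(4 − d₃) − (n′ − n₃)d₃)`, `p₁ = a₁ + 2n₃ − 2n′`, `q = a₂ + d₃ − 4`,
`h′ = a₂ − d₃`, `v′ = a₁ − 2n₃`: `W′·S + p₁h′ + qv′ = 2μ′ + 2(a₁ − n′)(a₂ − 2) − 4n′` (LEMMA FRAME's `|P′|`) as a polynomial identity; and in the five
h′ = 0 cells `(7, d₃, 21, d₃)` the isolated fibres carry `7·(2d₃ − 4) = 14d₃ − 28 = |P′| − W′·S` exactly. [`ring`] -/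
theorem pg24b_pprime_local :
    (∀ n' μ' n₃ d₃ a₁ a₂ : ℤ,
      2 * (μ' - n₃ * (4 - d₃) - (n' - n₃) * d₃) + (a₁ + 2 * n₃ - 2 * n') * (a₂ - d₃) + (a₂ + d₃ - 4) * (a₁ - 2 * n₃)
        = 2 * μ' + 2 * (a₁ - n') * (a₂ - 2) - 4 * n') ∧
    (∀ d₃ : ℤ, 7 * (2 * d₃ - 4) = 14 * d₃ - 28 ∧ (40 + 22 * d₃) - (68 + 8 * d₃) = 14 * d₃ - 28) := by
  refine ⟨fun n' μ' n₃ d₃ a₁ a₂ => by ring, fun d₃ => ⟨by ring, by ring⟩⟩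

/-- **[XXXVII] 11.2 (LEMMA POWERS, the counts).** On an isolated vertical S-fibre structure whose largest `x̃`-block has size `b`, the powers
`x̃^{j+2}` with `j + 2 ≤ b − 1` are non-zero: `b − 2` of them (`j = 0, …, b − 3`); on an ι-fixed fibre the invariant ones are the even powers
`x̃^{2i+2}`, `2i + 2 ≤ b − 1`: `(b − 1)/2` of them (integer division). Values: `b = 3, 4, 5, 6 ↦ (1, 1), (2, 1), (3, 2), (4, 2)`; `≥ 2` on a free orbit
iff `b ≥ 4`, on a fixed fibre iff `b ≥ 5`. [`omega`, `decide`] -/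
theorem pg24b_powers_counts :
    (∀ b : ℕ, 3 ≤ b → 1 ≤ b - 2 ∧ 1 ≤ (b - 1) / 2) ∧ (∀ b : ℕ, 4 ≤ b → 2 ≤ b - 2) ∧ (∀ b : ℕ, 5 ≤ b → 2 ≤ (b - 1) / 2) ∧
    ((3 - 2, (3 - 1) / 2) = (1, 1) ∧ (4 - 2, (4 - 1) / 2) = (2, 1) ∧ (5 - 2, (5 - 1) / 2) = (3, 2) ∧ (6 - 2, (6 - 1) / 2) = (4, 2)) := by
  refine ⟨fun b hb => ⟨by omega, by omega⟩, fun b hb => by omega, fun b hb => by omega, by decide⟩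

/-- **[XXXVII] 11.3 (LEMMA SQ, the thresholds).** An isolated square-zero structure of D′-multiplicity `μ` has `def = μ + μ − (2μ)/2 = μ` and
`D_C = μ(d₃ − 3)`; an attached free square-zero pair has `D ≥ 2μ(d₃ − 3) + 1 − τ/2`, which exceeds `1` unless `τ ≥ 4μ(d₃ − 3)`; with
`τ ≤ 2μ·M` (B-horizontal attachments of total multiplicity `M`) this needs `M ≥ 2(d₃ − 3)` — `≥ 14` and `τ ≥ 28μ` at `d₃ = 10`. [`omega`, `nlinarith`] -/
theorem pg24b_square_zero :
    (∀ μ : ℤ, μ + μ - (2 * μ) / 2 = μ) ∧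
    (∀ μ e τ : ℤ, 1 ≤ μ → 1 ≤ e → (2 * (2 * μ * e) + 2 - τ ≤ 2 ↔ 4 * μ * e ≤ τ)) ∧
    (∀ μ e M : ℤ, 1 ≤ μ → 4 * μ * e ≤ 2 * μ * M → 2 * e ≤ M) ∧
    ((2 : ℤ) * (10 - 3) = 14 ∧ ∀ μ : ℤ, 4 * μ * (10 - 3) = 28 * μ) := by
  refine ⟨fun μ => by omega, ?_, ?_, by norm_num, fun μ => by ring⟩
  · intro μ e τ _ _
    constructor <;> intro h <;> nlinarith
  · intro μ e M hμ h
    by_contra hc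
    have h1 : M + 1 ≤ 2 * e := by omega
    have h2 : 2 * μ * (M + 1) ≤ 2 * μ * (2 * e) := mul_le_mul_of_nonneg_left h1 (by linarith)
    nlinarith

/-- **[XXXVII] 11.4 (PROPOSITION ISO, the case analysis).** In an h′ = 0 cell (`d₃ ≥ 10`, so `d₃ − 3 ≥ 2`) a (0,1) object has
`1 ≥ n + (d₃ − 3)·s` with `n` = the number of isolated orbits having a block of size 3 or 4 and `s` = Σ def over the isolated structures (both
non-negative integers once blocks of size ≥ 5 are excluded): hence `s = 0` and `n ≤ 1`; and `(d₃ − 3)μ ≤ 1` with `μ ≥ 1` forces `d₃ = 4` — impossible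
for `d₃ ≥ 5`. The per-block deficit `2 + 2[b ≥ 2] − b` (doubled) vanishes on `{1,2,3,4}` only at `b = 4`. [`omega`, `nlinarith`] -/
theorem pg24b_iso_cases :
    (∀ n s e : ℕ, 2 ≤ e → n + e * s ≤ 1 → s = 0 ∧ n ≤ 1) ∧
    (∀ μ d₃ : ℕ, 1 ≤ μ → 5 ≤ d₃ → ¬ ((d₃ - 3) * μ ≤ 1)) ∧
    (∀ b : ℕ, 1 ≤ b → b ≤ 4 → ((2 + 2 * (if 2 ≤ b then 1 else 0) - b = 0) ↔ b = 4)) := by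
  refine ⟨?_, ?_, ?_⟩
  · intro n s e he h
    rcases Nat.eq_zero_or_pos s with hs | hs
    · exact ⟨hs, by omega⟩
    · exfalso
      have h2 : 2 * 1 ≤ e * s := Nat.mul_le_mul he hs
      generalize e * s = p at h h2
      omega
  · intro μ d₃ hμ hd h
    have h2 : 2 * 1 ≤ (d₃ - 3) * μ := Nat.mul_le_mul (by omega) hμ
    generalize (d₃ - 3) * μ = p at h h2
    omega
  · intro b h1 h4
    interval_cases b <;> decide

end ProductGroundTwentyFourB

end Summit.HodgeConjecture.HodgeConjecture.WeilTypeLadder
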